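import Summits.FinalStateConjecture.FinalStateConjecture.Theorems.PhotonSphereChannelsTameEternalLimitDefs
import Summits.FinalStateConjecture.FinalStateConjecture.Theorems.ZeroEnergyRigidity.Negative.MinkowskiPresentation
import Literature.Geometry.Lorentzian.MinkowskiGlobalHyperbolicity
import Literature.Geometry.Lorentzian.MinkowskiFlat
import Literature.Geometry.Lorentzian.KerrConvergenceProofs
import Literature.Geometry.Manifold.InverseFunctionTheorem
import HarnessLib

/-!
# Crux `ChannelsResolveTameDevelopmentsR` (stmt-FinalStateConjecture-14075), line
# `trapped-set-observability-analyticity` — stub `stub_omegaLimits` (S1), audit (A2):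
# the ω-limit TYPE `TameEternalLimit` is inhabited by exact Minkowski space

Anti-vacuity certificate for the conclusion `∃ E : TameEternalLimit, …` of S1 and for the
hypotheses `(E : TameEternalLimit)` of S2, S3, S6, S7: the witness of `stub_tameEternalLimitNonempty` is Minkowski
spacetime `(ℝ⁴, η, ∂ₜ)` (`Minkowski.spacetime`) with base point `0`, mass `M = 0`, inner radius
`R = 1`, far chart the INCLUSION of the eternal cylinder `Kerr.region 0 1 = ℝ_t × {|x| > 1}`, clock
`x⁰`, generator field `L = 0`. Every field is a theorem of the tree:

* `isRicciFlat` = `Minkowski.isRicciFlat_holds`; `isGloballyHyperbolic` = `Minkowski.isGloballyHyperbolic`;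
* the far chart has deviation `ι^* η − g_{0,0} = η − η = 0` (`Kerr.bilin_zero_left`,
  `OpensChart.mfderiv_subtypeVal_apply`), so `far_bounds` / `far_nonradiating` hold with `C = 0`;
  it is an injective local diffeomorphism (inverse function theorem at `dι = id`);
* `I⁺(cylinder) = I⁻(cylinder) = ℝ⁴` by straight timelike segments
  (`ZeroEnergyRigidity.Negative.mem_chronologicalFuture_of_lt`), hence `doc = ℝ⁴`, the base point
  lies in its closure, `Z ⊆ I⁺(range Φ)`, and the future event horizon `∂I⁻ ∩ I⁺` is EMPTY — all
  seven horizon clauses hold vacuously (with `𝒩 = ∅`, `f = 0`);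
* `tame k` for EVERY `k`: the translated identity chart `x ↦ q + x` on the unit ball is a late chart
  of the Minkowski background with deviation `0` and reads the clock as `x⁰ ↦ q⁰ + x⁰`
  (`tameClockChartAt_minkowski`).

So the structure `TameEternalLimit` is consistent (registered sub-goal
`stub_tameEternalLimitNonempty`, proof-only: the witness is built inline; a named
`def minkowskiTameEternalLimit` with the same fields sits in the line's evidence file), its
horizonless branch is realised, and (with `TameEternalLimit.redShifted_of_horizon_eq_empty`) the
Minkowski limit is `RedShifted κ₀` for every `κ₀`: the class quantified over by S3/S6 contains it.
-/

set_option linter.dupNamespace false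

noncomputable section

namespace Summit.FinalStateConjecture.FinalStateConjecture.Theorems.TrappedSet

open Literature.Geometry.Lorentzian
open Summit.FinalStateConjecture.FinalStateConjecture.Theorems.ZeroEnergyRigidity.Negative
open scoped Manifold ContDiff Topology ENNReal NNReal
open Filter Set Function TopologicalSpace

-- Below, the metric and time orientation of `Minkowski.spacetime` (its fields, by `rfl`) are
-- written out as `LorentzianMetric.ofLE Minkowski.metric le_top` / `TimeOrientation.ofLE …` with
-- carrier syntactically `E4`, so that the instances of `E4` apply (as in
-- `MinkowskiGlobalHyperbolicity.lean`; no local notation is declared).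

/-! ## §1 Charts of Minkowski spacetime with vanishing deviation -/

/-- The differential of the translated inclusion `x ↦ q + x` of an open `U ⊆ E4` is the identity.
[folklore] -/
theorem mfderiv_translate_subtypeVal_apply (U : Opens E4) (q : E4) (x : U) (v : E4) :
    mfderiv 𝓘(ℝ, E4) (𝓡 4) (fun y : U ↦ q + (y : E4)) x v = v := by
  have h1 : HasMFDerivAt 𝓘(ℝ, E4) 𝓘(ℝ, E4) (fun y : E4 ↦ q + y) (x : E4)
      (ContinuousLinearMap.id ℝ E4) :=
    ((hasFDerivAt_id (x : E4)).const_add q).hasMFDerivAt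
  have h2 : MDifferentiableAt 𝓘(ℝ, E4) 𝓘(ℝ, E4) (Subtype.val : U → E4) x :=
    (contMDiff_subtype_val (I := 𝓘(ℝ, E4)) (n := ∞)).mdifferentiableAt (by simp)
  have h3 := DFunLike.congr_fun (h1.comp x h2.hasMFDerivAt).mfderiv v
  have e1 := OpensChart.mfderiv_subtypeVal_apply x v
  exact h3.trans e1

/-- The translated inclusion `x ↦ q + x` of an open `U ⊆ E4` into Minkowski spacetime has
vanishing deviation from the Minkowski background on `U` (`η(d(q+x) v, d(q+x) w) − η(v, w) = 0`).
[folklore] -/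
theorem deviation_minkowski_translate (U : Opens E4) (q : E4) (x : U) :
    Minkowski.spacetime.deviation (Minkowski.backgroundOn U) (fun y : U ↦ q + (y : E4)) x = 0 := by
  ext v w
  change Minkowski.bilin (mfderiv 𝓘(ℝ, E4) (𝓡 4) (fun y : U ↦ q + (y : E4)) x v)
      (mfderiv 𝓘(ℝ, E4) (𝓡 4) (fun y : U ↦ q + (y : E4)) x w) - Minkowski.bilin v w = 0
  rw [mfderiv_translate_subtypeVal_apply, mfderiv_translate_subtypeVal_apply, sub_self]

/-- Hence its extended deviation vanishes identically on `E4`. [folklore] -/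
theorem deviationExtend_minkowski_translate (U : Opens E4) (q : E4) :
    Minkowski.spacetime.deviationExtend (Minkowski.backgroundOn U) (fun y : U ↦ q + (y : E4)) = 0 := by
  funext y
  by_cases hy : y ∈ U
  · have := Minkowski.spacetime.deviationExtend_coe (Minkowski.backgroundOn U)
      (fun y : U ↦ q + (y : E4)) ⟨y, hy⟩
    rw [deviation_minkowski_translate] at this
    exact this
  · have h : ¬ ∃ a : U, (a : E4) = y := fun ⟨a, ha⟩ ↦ hy (ha ▸ a.2)
    exact Function.extend_apply' _ _ _ h

/-- The translated inclusion of the coordinate ball `B(0, r₀)` is a late-time chart of Minkowski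
spacetime on the Minkowski background over the ball, after time `−r₀` (smooth; an open embedding on
the open late region; image in `univ`). [folklore] -/
theorem isLateChart_minkowski_translate (r₀ : ℝ) (q : E4) :
    Minkowski.spacetime.IsLateChart
      (Minkowski.backgroundOn ⟨Metric.ball (0 : E4) r₀, Metric.isOpen_ball⟩) univ (-r₀)
      (fun y : (⟨Metric.ball (0 : E4) r₀, Metric.isOpen_ball⟩ : Opens E4) ↦ q + (y : E4)) := by
  set U : Opens E4 := ⟨Metric.ball (0 : E4) r₀, Metric.isOpen_ball⟩
  refine ⟨?_, ?_, fun _ _ ↦ trivial⟩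
  · exact (contMDiff_iff_contDiff.mpr (contDiff_const.add contDiff_id) :
        ContMDiff 𝓘(ℝ, E4) 𝓘(ℝ, E4) ∞ fun y : E4 ↦ q + y).comp
      (contMDiff_subtype_val (I := 𝓘(ℝ, E4)) (n := ∞))
  · have hlate : IsOpen ((Minkowski.backgroundOn U).lateRegion (-r₀)) :=
      isOpen_lt continuous_const ((PiLp.continuous_apply 2 _ 0).comp continuous_subtype_val)
    exact (Homeomorph.addLeft q).isOpenEmbedding.comp
      ((IsOpen.isOpenEmbedding_subtypeVal U.isOpen).comp (IsOpen.isOpenEmbedding_subtypeVal hlate))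

/-- **Minkowski spacetime is `Cᵏ`-tame for every `k` in the clock `x⁰`, at every point, for every
radius `r₀ > 0` and every `Λ`**: the translated identity chart on `B(0, r₀)` has deviation `0` and
reads the clock as `(q + x)⁰ = q⁰ + x⁰`. [folklore] -/
theorem tameClockChartAt_minkowski (k : ℕ) {r₀ : ℝ} (hr₀ : 0 < r₀) (Λ : NNReal) (q : E4) :
    TameClockChartAt Minkowski.spacetime (fun x : E4 ↦ x 0) k r₀ Λ q := by
  set U : Opens E4 := ⟨Metric.ball (0 : E4) r₀, Metric.isOpen_ball⟩
  refine ⟨fun y : U ↦ q + (y : E4), isLateChart_minkowski_translate r₀ q,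
    ⟨⟨0, Metric.mem_ball_self hr₀⟩, rfl, by simp⟩, ?_, ?_, fun x ↦ ?_⟩
  · change supCkENorm (U : Set E4) k
      (Minkowski.spacetime.deviationExtend (Minkowski.backgroundOn U) fun y : U ↦ q + (y : E4)) ≤ _
    rw [deviationExtend_minkowski_translate, supCkENorm_zero]
    exact zero_le
  · change supCkENorm (U : Set E4) 0
      (Minkowski.spacetime.deviationExtend (Minkowski.backgroundOn U) fun y : U ↦ q + (y : E4)) ≤ _
    rw [deviationExtend_minkowski_translate, supCkENorm_zero]
    exact zero_le
  · change (q + (x : E4)) 0 = q 0 + (x : E4) 0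
    rfl

/-! ## §2 The eternal far chart: the inclusion of the cylinder `Kerr.region 0 R` -/

/-- The inclusion of the cylinder `ℝ_t × {|x| > R}` into Minkowski spacetime has vanishing
deviation from the far background `(Kerr.region 0 R, g_{0,0} = η, x⁰, |x|)`. [folklore] -/
theorem deviation_minkowski_farChart (R : ℝ) (x : Kerr.region (0 : ℝ) R) :
    Minkowski.spacetime.deviation (farBackground 0 R)
      (Subtype.val : Kerr.region (0 : ℝ) R → E4) x = 0 := by
  ext v w
  change Minkowski.bilin (mfderiv 𝓘(ℝ, E4) 𝓘(ℝ, E4) (Subtype.val : Kerr.region (0 : ℝ) R → E4) x v)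
      (mfderiv 𝓘(ℝ, E4) 𝓘(ℝ, E4) (Subtype.val : Kerr.region (0 : ℝ) R → E4) x w) -
    Kerr.bilin 0 0 x v w = 0
  rw [OpensChart.mfderiv_subtypeVal_apply, OpensChart.mfderiv_subtypeVal_apply,
    Kerr.bilin_zero_left, sub_self]

/-- Hence the extended far deviation vanishes identically. [folklore] -/
theorem deviationExtend_minkowski_farChart (R : ℝ) :
    Minkowski.spacetime.deviationExtend (farBackground 0 R)
      (Subtype.val : Kerr.region (0 : ℝ) R → E4) = 0 := by
  funext y
  by_cases hy : y ∈ Kerr.region (0 : ℝ) R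
  · have := Minkowski.spacetime.deviationExtend_coe (farBackground 0 R)
      (Subtype.val : Kerr.region (0 : ℝ) R → E4) ⟨y, hy⟩
    rw [deviation_minkowski_farChart] at this
    exact this
  · have h : ¬ ∃ a : Kerr.region (0 : ℝ) R, (a : E4) = y := fun ⟨a, ha⟩ ↦ hy (ha ▸ a.2)
    exact Function.extend_apply' _ _ _ h

/-- The inclusion of an open subset of `E4` into Minkowski spacetime is a `C^∞` local
diffeomorphism (inverse function theorem at `dι = id`). [folklore] -/
theorem isLocalDiffeomorph_subtypeVal_minkowski (U : Opens E4) :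
    IsLocalDiffeomorph 𝓘(ℝ, E4) (𝓡 4) ((⊤ : ℕ∞) : WithTop ℕ∞)
      (Subtype.val : U → Minkowski.spacetime.carrier) := by
  intro x
  refine Literature.Geometry.Manifold.isLocalDiffeomorphAt_of_mfderiv (by simp) isOpen_univ
    (mem_univ x) (contMDiff_subtype_val (I := 𝓘(ℝ, E4)) (n := ∞)).contMDiffOn
    (ContinuousLinearEquiv.refl ℝ E4) ?_
  ext v
  exact OpensChart.mfderiv_subtypeVal_apply x v

/-! ## §3 Causal anatomy of the cylinder end: `I⁺ = I⁻ = ℝ⁴`, `doc = ℝ⁴`, `𝓗⁺ = ∅` -/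

/-- A point `(t, y)` with `‖y‖ > max R 0` lies on the cylinder `Kerr.region 0 R`
(`r(0, ·) = |x̲|`). [folklore] -/
theorem ofTimeSpace_mem_region {R : ℝ} {y : E3} (hy : max R 0 < ‖y‖) (t : ℝ) :
    E4.ofTimeSpace t y ∈ Set.range (Subtype.val : Kerr.region (0 : ℝ) R → E4) := by
  refine ⟨⟨E4.ofTimeSpace t y, ?_⟩, rfl⟩
  rw [Kerr.mem_region, Kerr.radius_zero_left, E4.spatialNorm_ofTimeSpace]
  exact hy

/-- **`I⁺(cylinder) = ℝ⁴`** in Minkowski spacetime: every event is reached by a straight timelike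
segment from an early point of the cylinder. [folklore] -/
theorem chronologicalFuture_farCylinder_eq_univ (R : ℝ) :
    (LorentzianMetric.ofLE (n' := (∞ : ℕ∞ω)) Minkowski.metric le_top).chronologicalFuture
      (TimeOrientation.ofLE (n' := (∞ : ℕ∞ω)) Minkowski.timeOrientation le_top)
      (Set.range (Subtype.val : Kerr.region (0 : ℝ) R → E4)) = (univ : Set E4) := by
  refine eq_univ_of_forall fun p ↦ ?_
  obtain ⟨y₀, hny⟩ := exists_norm_eq E3 (show (0 : ℝ) ≤ max R 0 + 1 by positivity)
  have hq : E4.ofTimeSpace (p 0 - ‖y₀ - E4.spatial p‖ - 1) y₀ ∈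
      Set.range (Subtype.val : Kerr.region (0 : ℝ) R → E4) :=
    ofTimeSpace_mem_region (by rw [hny]; linarith) _
  have hp := mem_chronologicalFuture_ofTimeSpace p y₀
    (t := p 0 - ‖y₀ - E4.spatial p‖ - 1) (by linarith)
  exact LorentzianMetric.chronologicalFuture_mono (singleton_subset_iff.mpr hq) hp

/-- **`I⁻(cylinder) = ℝ⁴`** in Minkowski spacetime: every event reaches a late point of the
cylinder by a straight timelike segment. [folklore] -/
theorem chronologicalPast_farCylinder_eq_univ (R : ℝ) :
    (LorentzianMetric.ofLE (n' := (∞ : ℕ∞ω)) Minkowski.metric le_top).chronologicalPast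
      (TimeOrientation.ofLE (n' := (∞ : ℕ∞ω)) Minkowski.timeOrientation le_top)
      (Set.range (Subtype.val : Kerr.region (0 : ℝ) R → E4)) = (univ : Set E4) := by
  refine eq_univ_of_forall fun p ↦ ?_
  rw [LorentzianMetric.mem_chronologicalPast_iff_exists]
  obtain ⟨y₀, hny⟩ := exists_norm_eq E3 (show (0 : ℝ) ≤ max R 0 + 1 by positivity)
  exact ⟨E4.ofTimeSpace (p 0 + ‖y₀ - E4.spatial p‖ + 1) y₀,
    ofTimeSpace_mem_region (by rw [hny]; linarith) _,
    ofTimeSpace_mem_chronologicalFuture p y₀ (by linarith)⟩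

/-- The d.o.c. `I⁺ ∩ I⁻` of the cylinder end of Minkowski spacetime is all of `ℝ⁴`. [folklore] -/
theorem docOfEnd_farCylinder_eq_univ (R : ℝ) :
    Minkowski.spacetime.docOfEnd (Set.range (Subtype.val : Kerr.region (0 : ℝ) R → E4)) = univ := by
  change (LorentzianMetric.ofLE (n' := (∞ : ℕ∞ω)) Minkowski.metric le_top).chronologicalFuture
      (TimeOrientation.ofLE (n' := (∞ : ℕ∞ω)) Minkowski.timeOrientation le_top)
      (Set.range (Subtype.val : Kerr.region (0 : ℝ) R → E4)) ∩
    (LorentzianMetric.ofLE (n' := (∞ : ℕ∞ω)) Minkowski.metric le_top).chronologicalPast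
      (TimeOrientation.ofLE (n' := (∞ : ℕ∞ω)) Minkowski.timeOrientation le_top)
      (Set.range (Subtype.val : Kerr.region (0 : ℝ) R → E4)) = (univ : Set E4)
  rw [chronologicalFuture_farCylinder_eq_univ, chronologicalPast_farCylinder_eq_univ, univ_inter]

/-- **The cylinder end of Minkowski spacetime has EMPTY future event horizon**
`∂I⁻(cylinder) ∩ I⁺(cylinder) = ∂ℝ⁴ ∩ ℝ⁴ = ∅`. [folklore] -/
theorem futureEventHorizonOfEnd_farCylinder_eq_empty (R : ℝ) :
    Minkowski.spacetime.futureEventHorizonOfEnd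
      (Set.range (Subtype.val : Kerr.region (0 : ℝ) R → E4)) = ∅ := by
  change frontier ((LorentzianMetric.ofLE (n' := (∞ : ℕ∞ω)) Minkowski.metric le_top).chronologicalPast
      (TimeOrientation.ofLE (n' := (∞ : ℕ∞ω)) Minkowski.timeOrientation le_top)
      (Set.range (Subtype.val : Kerr.region (0 : ℝ) R → E4))) ∩
    (LorentzianMetric.ofLE (n' := (∞ : ℕ∞ω)) Minkowski.metric le_top).chronologicalFuture
      (TimeOrientation.ofLE (n' := (∞ : ℕ∞ω)) Minkowski.timeOrientation le_top)
      (Set.range (Subtype.val : Kerr.region (0 : ℝ) R → E4)) = (∅ : Set E4)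
  rw [chronologicalPast_farCylinder_eq_univ, frontier_univ, empty_inter]

/-! ## §4 The Minkowski tame eternal limit -/

/-- Registered sub-goal `stub_tameEternalLimitNonempty` of `stub_omegaLimits` (S1), audit (A2):
**the ω-limit type of the line is inhabited — by exact Minkowski space** (`Z = (ℝ⁴, η, ∂ₜ)`,
`z = 0`, `M = 0`, `R = 1`, far chart the inclusion of `ℝ_t × {|x| > 1}`, clock `x⁰`, `L = 0`;
empty horizon, so every horizon clause is vacuous; d.o.c. everything).  The anti-vacuity
certificate of the conclusion of S1 and of the hypotheses `(E : TameEternalLimit)` of S2/S3/S6/S7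
(with `TameEternalLimit.redShifted_of_horizon_eq_empty` the witness is `RedShifted κ₀` for every
`κ₀`).  A named `def minkowskiTameEternalLimit` with the same fields is kept in the line's evidence
file (definitions are review-queued; this file is proof-only). [folklore] -/
theorem stub_tameEternalLimitNonempty :
    ∃ E : TameEternalLimit, E.M = 0 ∧ E.horizon = ∅ ∧ E.doc = Set.univ := by
  refine ⟨
    { Z := Minkowski.spacetime
      z := (0 : E4)
      M := 0
      R := 1
      Φ := Subtype.val
      t := fun x : E4 ↦ x 0
      L := fun _ ↦ 0
      mass_nonneg := le_rfl
      lt_R := by norm_num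
      isRicciFlat := by
        intro hLC
        haveI : Minkowski.smoothMetric.toPseudoRiemannianMetric.HasLeviCivita := hLC
        exact Minkowski.isRicciFlat_holds
      isGloballyHyperbolic := Minkowski.isGloballyHyperbolic
      subset_chronologicalFuture := by
        change (univ : Set E4) ⊆ (LorentzianMetric.ofLE (n' := (∞ : ℕ∞ω)) Minkowski.metric le_top).chronologicalFuture
          (TimeOrientation.ofLE (n' := (∞ : ℕ∞ω)) Minkowski.timeOrientation le_top)
          (Set.range (Subtype.val : Kerr.region (0 : ℝ) 1 → E4))
        rw [chronologicalFuture_farCylinder_eq_univ]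
      isLocalDiffeomorph_far := isLocalDiffeomorph_subtypeVal_minkowski _
      injective_far := Subtype.val_injective
      far_bounds k := ⟨0, fun m _ x ↦ by
        rw [deviationExtend_minkowski_farChart, iteratedFDeriv_zero (𝕜 := ℝ)]
        simp⟩
      far_nonradiating m δ hδ := ⟨0, fun x _ ↦ by
        have h0 : (fun y : E4 ↦ fderiv ℝ (Minkowski.spacetime.deviationExtend (farBackground 0 1)
            (Subtype.val : Kerr.region (0 : ℝ) 1 → E4)) y (Literature.Geometry.Lorentzian.E4.basisVector 0)) = 0 := by
          funext y
          rw [deviationExtend_minkowski_farChart]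
          simp
        rw [h0, iteratedFDeriv_zero (𝕜 := ℝ)]
        simpa using hδ.le⟩
      far_clock _ := rfl
      contMDiff_clock := contMDiff_iff_contDiff.mpr (contDiff_piLp_apply (p := 2))
      tame k := ⟨1, one_pos, 0, fun q _ ↦ tameClockChartAt_minkowski k one_pos 0 q⟩
      basepoint_mem := by
        change (0 : E4) ∈ closure (Minkowski.spacetime.docOfEnd
          (Set.range (Subtype.val : Kerr.region (0 : ℝ) 1 → E4)))
        rw [docOfEnd_farCylinder_eq_univ, closure_univ]
        exact mem_univ _
      contMDiffOn_generator := ⟨∅, isOpen_empty, by rw [futureEventHorizonOfEnd_farCylinder_eq_empty],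
        fun _ h ↦ h.elim⟩
      generator_null p hp := by
        rw [futureEventHorizonOfEnd_farCylinder_eq_empty] at hp
        exact hp.elim
      generator_tangent γ _ h0 := by
        rw [futureEventHorizonOfEnd_farCylinder_eq_empty] at h0
        exact h0.elim
      generator_complete p hp := by
        rw [futureEventHorizonOfEnd_farCylinder_eq_empty] at hp
        exact hp.elim
      horizon_regular := by
        refine ⟨∅, fun _ ↦ 0, isOpen_empty, ?_, fun _ h ↦ h.elim, ?_, ?_⟩
        · rw [futureEventHorizonOfEnd_farCylinder_eq_empty]
        · rw [futureEventHorizonOfEnd_farCylinder_eq_empty]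
          ext p
          simp
        · intro p hp
          rw [futureEventHorizonOfEnd_farCylinder_eq_empty] at hp
          exact hp.elim
      isCompact_horizonSlice c := by
        rw [futureEventHorizonOfEnd_farCylinder_eq_empty, empty_inter]
        exact isCompact_empty
      nonexpanding := by
        intro _ p hp
        rw [futureEventHorizonOfEnd_farCylinder_eq_empty] at hp
        exact hp.elim }, rfl, ?_, ?_⟩
  · change Minkowski.spacetime.futureEventHorizonOfEnd
      (Set.range (Subtype.val : Kerr.region (0 : ℝ) 1 → E4)) = ∅
    exact futureEventHorizonOfEnd_farCylinder_eq_empty 1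
  · change Minkowski.spacetime.docOfEnd (Set.range (Subtype.val : Kerr.region (0 : ℝ) 1 → E4)) = univ
    exact docOfEnd_farCylinder_eq_univ 1

end Summit.FinalStateConjecture.FinalStateConjecture.Theorems.TrappedSet

end
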